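import Literature.AnabelianGeometry.SemiGraphs.TemperedReconstructionR2bCompatProofs
import Literature.AnabelianGeometry.SemiGraphs.TemperedReconstructionR0CompatProofs
import Literature.AnabelianGeometry.SemiGraphs.TemperedReconstructionR4Proofs
import Literature.AnabelianGeometry.SemiGraphs.TemperedReconstructionR1Proofs
import Literature.AnabelianGeometry.SemiGraphs.TemperedReconstructionCompatProofs
import HarnessLib

/-!
# [SemiAnbd] Cor. 3.9 (b), uniqueness of the UNDERLYING MORPHISM OF SEMI-GRAPHS (proof-only)

Mochizuki, *Semi-graphs of anabelioids*, Publ. RIMS **42** (2006), §3, Cor. 3.9, proof p. 268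
("φ arises from a morphism of graphs of anabelioids which [again by Theorem 3.7, (iii), (iv)] is
manifestly unique") [cite: MochizukiSemiAnbd2006, Cor 3.9 pp.42-43].

The typed twin `Cor39Compat` records uniqueness of the vertex map and of the edge map of a locally
open `F` inducing `φ`.  Here the remaining component of the underlying `SemiGraph.Hom` — the map of
BRANCHES — is shown to be determined as well (`compatible_branchMap_eq`; this is where the loop case
`F v₁ = F v₂` needs the 2-cells `F.comm`: the image `φ(ψ_v(Π_b))` sits in the branch subgroup of
`F b` inside the host through `F b`, and total estrangement — t11's `branch_eq_of_hosts_eq` — forbids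
a second branch of the same host from containing it), whence `compatible_base_eq : F.base = F'.base`
and the `Induces` form `base_eq_of_induces` (via R1 `InducesCompatible_holds`), modulo Thm. 3.7
(iii) `CompactInVerticial` (entering only through the edge map, R4); the branch-map clause itself is
UNCONDITIONAL (`branchMap_eq_of_compatV`, Thm. 3.7 (i), (ii) being theorems of the tree).

Finally the CAPSTONE under the compatible reading (ruling χ2), binding everything the tree has
proved: `cor39Compat_of_compactInVerticial : CompactInVerticial → InducesOfCompatible → Cor39Compat`
(t2's `cor39Compat_of_thm37_i_iii` with R2′ discharged by `quasiGeometricGraphDataCompat_of_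
compactInVerticial`) and the sharper `cor39Compat_bijection_of_compactInVerticial`: (a′) a
homomorphism induced by a locally open `F` is COMPATIBLY quasi-geometric (R1 ≫ R0′
`isCompatiblyQuasiGeometric_of_compat`) and (b′) a compatibly quasi-geometric `φ` is induced by a
locally open `F` whose underlying morphism of semi-graphs is unique — i.e. "locally open `F` ↦
`B^temp(F)`" is a bijection onto the compatibly quasi-geometric homomorphisms at the level of
underlying graph morphisms, modulo Thm. 3.7 (iii) and the step R3 `InducesOfCompatible`.

Nothing here takes a side on [IUTchIII] Cor. 3.12; typed ≠ discharged.
-/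

namespace Literature.AnabelianGeometry.SemiGraphs

namespace ProfiniteSemiGraph

universe u

variable {𝒢 ℋ : ProfiniteSemiGraph.{u}}

/-- **The host through `F b`.**  For `φ` compatible at `v` with a locally open `F` (`φ ∘ ψ =
γ_c ∘ Ψ ∘ F_v`), the image `φ(ψ(Π_b))` of the branch subgroup of a branch `b` at `v` is a NONTRIVIAL
subgroup of the branch subgroup of `F b` in the host `m · Ψ(Π_{F v}) · m⁻¹ = c · Ψ(Π_{F v}) · c⁻¹`
(read off the 2-cell `F.comm` at `b`). [cite: MochizukiSemiAnbd2006, Cor 3.9 pp.42-43] -/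
theorem exists_map_branchSubgroup_le_of_compat (h37i : VerticialInjective.{u})
    (hℋ : Cor39Hypotheses ℋ) (cℋ : TemperedPiChart ℋ) {P : Type u} [Group P] (F : Hom 𝒢 ℋ)
    (φ : P →* cℋ.G) (hF : F.IsLocallyOpen) {b : 𝒢.graph.Branch} {v : 𝒢.graph.Vertex}
    (hv : 𝒢.graph.abuts b = some v) (ψ : 𝒢.Gv v →* P)
    (Ψ : ℋ.Gv (F.base.vertexMap v) →ₜ* cℋ.G) (hΨ : IsVerticialHom cℋ (F.base.vertexMap v) Ψ)
    (c : cℋ.G) (hc : ∀ y, φ (ψ y) = c * Ψ (F.hV v y) * c⁻¹) :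
    ∃ m : cℋ.G,
      Ψ.toMonoidHom.range.map (MulAut.conj m).toMonoidHom =
          Ψ.toMonoidHom.range.map (MulAut.conj c).toMonoidHom ∧
        ((𝒢.branchSubgroup b v hv).map ψ).map φ ≤
          ((ℋ.branchSubgroup (F.base.branchMap b) (F.base.vertexMap v)
            (F.base.abuts_branchMap b v hv)).map Ψ.toMonoidHom).map (MulAut.conj m).toMonoidHom ∧
        ((𝒢.branchSubgroup b v hv).map ψ).map φ ≠ ⊥ := by
  have hℋ37 := hℋ.thm37Hypotheses
  obtain ⟨γ, hγ⟩ := F.exists_conj b v hv (F.base.edgeMap (𝒢.graph.edgeOf b)) rfl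
    (F.base.edgeOf_branchMap b)
  have hγz : ∀ z, γ * ℋ.brHomAt (F.base.branchMap b) (F.base.vertexMap v)
      (F.base.abuts_branchMap b v hv) _ (F.base.edgeOf_branchMap b) (F.hE _ z) * γ⁻¹ =
      F.hV v (𝒢.brHom b v hv z) := fun z => by
    have h := hγ z
    rw [Hom.hEAt_rfl] at h
    exact h
  refine ⟨c * Ψ γ, ?_, ?_, ?_⟩
  · apply le_antisymm
    · rintro _ ⟨_, ⟨y, rfl⟩, rfl⟩
      refine ⟨Ψ (γ * y * γ⁻¹), ⟨_, rfl⟩, ?_⟩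
      show c * Ψ (γ * y * γ⁻¹) * c⁻¹ = c * Ψ γ * Ψ y * (c * Ψ γ)⁻¹
      rw [map_mul Ψ, map_mul Ψ, map_inv Ψ]
      group
    · rintro _ ⟨_, ⟨y, rfl⟩, rfl⟩
      refine ⟨Ψ (γ⁻¹ * y * γ), ⟨_, rfl⟩, ?_⟩
      show c * Ψ γ * Ψ (γ⁻¹ * y * γ) * (c * Ψ γ)⁻¹ = c * Ψ y * c⁻¹
      rw [map_mul Ψ, map_mul Ψ, map_inv Ψ]
      group
  · rintro _ ⟨_, ⟨_, ⟨z, rfl⟩, rfl⟩, rfl⟩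
    refine ⟨Ψ (ℋ.brHomAt (F.base.branchMap b) (F.base.vertexMap v) (F.base.abuts_branchMap b v hv)
        _ (F.base.edgeOf_branchMap b) (F.hE _ z)), ⟨_, brHomAt_mem_branchSubgroup _ _ _, rfl⟩, ?_⟩
    show c * Ψ γ * Ψ (ℋ.brHomAt (F.base.branchMap b) (F.base.vertexMap v)
        (F.base.abuts_branchMap b v hv) _ (F.base.edgeOf_branchMap b) (F.hE _ z)) * (c * Ψ γ)⁻¹ =
        φ (ψ (𝒢.brHom b v hv z))
    rw [hc, ← hγz z, map_mul Ψ, map_mul Ψ, map_inv Ψ]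
    group
  · -- nontriviality: `F` is locally open and `Π_{F e}` is infinite
    intro h0
    have hopen := hF.2 (𝒢.graph.edgeOf b)
    have key : ∀ (f : ℋ.graph.Edge) (qq : ℋ.graph.edgeOf (F.base.branchMap b) = f)
        (η : 𝒢.Ge (𝒢.graph.edgeOf b) →ₜ* ℋ.Ge f), IsOpen (η.toMonoidHom.range : Set (ℋ.Ge f)) →
        (∀ z, φ (ψ (𝒢.brHom b v hv z)) =
          (c * Ψ γ) * Ψ (ℋ.brHomAt (F.base.branchMap b) (F.base.vertexMap v)
            (F.base.abuts_branchMap b v hv) f qq (η z)) * (c * Ψ γ)⁻¹) → False := by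
      intro f qq η hη hφ
      subst qq
      apply ne_bot_of_isOpen_ge hℋ37.toProp36Hypotheses (F.base.abuts_branchMap b v hv) hη
      rw [eq_bot_iff]
      rintro _ ⟨z, rfl⟩
      have hz : φ (ψ (𝒢.brHom b v hv z)) ∈ ((𝒢.branchSubgroup b v hv).map ψ).map φ :=
        ⟨_, ⟨_, ⟨z, rfl⟩, rfl⟩, rfl⟩
      rw [h0, Subgroup.mem_bot, hφ z] at hz
      have h1 : Ψ (ℋ.brHomAt (F.base.branchMap b) (F.base.vertexMap v)
          (F.base.abuts_branchMap b v hv) _ rfl (η z)) = 1 := by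
        have := hz; rw [mul_inv_eq_one, mul_eq_left] at this; exact this
      have h2 := (h37i ℋ hℋ37 cℋ _).2 Ψ hΨ (by rw [h1, map_one] : Ψ _ = Ψ 1)
      exact brHomAt_injective hℋ.isOfInjectiveType (F.base.abuts_branchMap b v hv) rfl
        (by rw [h2, map_one] : ℋ.brHomAt _ _ _ _ rfl (η z) = ℋ.brHomAt _ _ _ _ rfl 1)
    refine key _ (F.base.edgeOf_branchMap b) (F.hE _) hopen fun z => ?_
    rw [hc, ← hγz z, map_mul Ψ, map_mul Ψ, map_inv Ψ]
    group

/-- **The host of `φ(ψ(Π_v))` is `c · Ψ(Π_{F v}) · c⁻¹`, with finite index** (local openness of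
`F` at `v`). [cite: MochizukiSemiAnbd2006, Cor 3.9 pp.42-43] -/
theorem relIndex_map_range_ne_zero_of_compat (h37i : VerticialInjective.{u})
    (hℋ : Cor39Hypotheses ℋ) (cℋ : TemperedPiChart ℋ) {P : Type u} [Group P] (F : Hom 𝒢 ℋ)
    (φ : P →* cℋ.G) (hF : F.IsLocallyOpen) (v : 𝒢.graph.Vertex) (ψ : 𝒢.Gv v →* P)
    (Ψ : ℋ.Gv (F.base.vertexMap v) →ₜ* cℋ.G) (hΨ : IsVerticialHom cℋ (F.base.vertexMap v) Ψ)
    (c : cℋ.G) (hc : ∀ y, φ (ψ y) = c * Ψ (F.hV v y) * c⁻¹) :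
    (ψ.range.map φ).relIndex (Ψ.toMonoidHom.range.map (MulAut.conj c).toMonoidHom) ≠ 0 := by
  have hℋ37 := hℋ.thm37Hypotheses
  -- through the injective `j = γ_c ∘ Ψ`
  let j : ℋ.Gv (F.base.vertexMap v) →* cℋ.G := (MulAut.conj c).toMonoidHom.comp Ψ.toMonoidHom
  have hj : Function.Injective j := fun a₁ a₂ h =>
    (h37i ℋ hℋ37 cℋ _).2 Ψ hΨ ((MulAut.conj c).injective h)
  let U : Subgroup (ℋ.Gv (F.base.vertexMap v)) := (F.hV v).toMonoidHom.range
  have hS : ψ.range.map φ = U.map j := by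
    ext y
    constructor
    · rintro ⟨_, ⟨x, rfl⟩, rfl⟩
      exact ⟨F.hV v x, ⟨x, rfl⟩, (hc x).symm⟩
    · rintro ⟨_, ⟨x, rfl⟩, rfl⟩
      exact ⟨ψ x, ⟨x, rfl⟩, hc x⟩
  have hW : Ψ.toMonoidHom.range.map (MulAut.conj c).toMonoidHom =
      (⊤ : Subgroup (ℋ.Gv (F.base.vertexMap v))).map j := by
    rw [MonoidHom.range_eq_map, Subgroup.map_map]
  have hU : U.index ≠ 0 := by
    haveI := Subgroup.quotient_finite_of_isOpen U (hF.1 v)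
    exact Subgroup.index_ne_zero_of_finite
  rw [hS, hW, Subgroup.relIndex_map_map_of_injective _ _ hj, Subgroup.relIndex_top_right]
  exact hU

/-- **Cor. 3.9 (b), uniqueness of the branch maps** ("manifestly unique", p. 268): two locally open
morphisms `F, F' : G → H` of semi-graphs of anabelioids (with `G` a graph) that are both compatible
with the same `φ` on verticial homomorphisms have the same map of branches — by total estrangement of
`H` (Thm. 3.7 (i), (ii)). [cite: MochizukiSemiAnbd2006, Cor 3.9 pp.42-43] -/
theorem compatible_branchMap_eq (h37i : VerticialInjective.{u}) (h37ii : VerticialDistinct.{u})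
    (h𝒢 : Cor39Hypotheses 𝒢) (hℋ : Cor39Hypotheses ℋ)
    (c𝒢 : TemperedPiChart 𝒢) (cℋ : TemperedPiChart ℋ) {F F' : Hom 𝒢 ℋ} {φ : c𝒢.G →ₜ* cℋ.G}
    (hF : F.IsLocallyOpen) (hF' : F'.IsLocallyOpen) (hV : F.CompatV c𝒢 cℋ φ)
    (hV' : F'.CompatV c𝒢 cℋ φ) : F.base.branchMap = F'.base.branchMap := by
  classical
  funext b
  have h𝒢37 := h𝒢.thm37Hypotheses
  have hℋ37 := hℋ.thm37Hypotheses
  -- `b` abuts to a vertex `v` (`G` is a graph)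
  obtain ⟨v, hv⟩ := Option.isSome_iff_exists.mp (h𝒢.isGraph.abuts_isSome b)
  -- verticial homomorphisms
  obtain ⟨⟨_, ψ, ⟨eψ⟩, rfl⟩, -⟩ := h37i 𝒢 h𝒢37 c𝒢 v
  choose Ψ hΨ using exists_isVerticialHom_of_thm37i h37i hℋ37 cℋ
  obtain ⟨c₁, hc₁⟩ := hV v ψ (Ψ _) ⟨eψ⟩ (hΨ _)
  obtain ⟨c₂, hc₂⟩ := hV' v ψ (Ψ _) ⟨eψ⟩ (hΨ _)
  -- the hosts through `F b` and `F' b`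
  obtain ⟨m₁, hm₁, hle₁, hne₁⟩ := exists_map_branchSubgroup_le_of_compat h37i hℋ cℋ F
    φ.toMonoidHom hF hv ψ.toMonoidHom (Ψ _) (hΨ _) c₁ hc₁
  obtain ⟨m₂, hm₂, hle₂, -⟩ := exists_map_branchSubgroup_le_of_compat h37i hℋ cℋ F'
    φ.toMonoidHom hF' hv ψ.toMonoidHom (Ψ _) (hΨ _) c₂ hc₂
  have hW₁ : (Ψ (F.base.vertexMap v)).toMonoidHom.range.map (MulAut.conj m₁).toMonoidHom ∈
      verticialSubgroups cℋ (F.base.vertexMap v) :=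
    conj_mem_verticialSubgroups cℋ (range_mem_verticialSubgroups cℋ (Ψ _) (hΨ _)) m₁
  have hW₂ : (Ψ (F'.base.vertexMap v)).toMonoidHom.range.map (MulAut.conj m₂).toMonoidHom ∈
      verticialSubgroups cℋ (F'.base.vertexMap v) :=
    conj_mem_verticialSubgroups cℋ (range_mem_verticialSubgroups cℋ (Ψ _) (hΨ _)) m₂
  -- both hosts contain `S = φ(ψ(Π_v))`, the first with finite index: they coincide
  have hS₁ : (ψ.toMonoidHom.range.map φ.toMonoidHom).relIndex
      ((Ψ (F.base.vertexMap v)).toMonoidHom.range.map (MulAut.conj m₁).toMonoidHom) ≠ 0 := by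
    rw [hm₁]
    exact relIndex_map_range_ne_zero_of_compat h37i hℋ cℋ F φ.toMonoidHom hF v ψ.toMonoidHom
      (Ψ _) (hΨ _) c₁ hc₁
  have hS₂ : ψ.toMonoidHom.range.map φ.toMonoidHom ≤
      (Ψ (F'.base.vertexMap v)).toMonoidHom.range.map (MulAut.conj m₂).toMonoidHom := by
    rw [hm₂]
    rintro _ ⟨_, ⟨x, rfl⟩, rfl⟩
    exact ⟨Ψ _ (F'.hV v x), ⟨F'.hV v x, rfl⟩, (hc₂ x).symm⟩
  have hW₂W₁ : ((Ψ (F'.base.vertexMap v)).toMonoidHom.range.map (MulAut.conj m₂).toMonoidHom).relIndex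
      ((Ψ (F.base.vertexMap v)).toMonoidHom.range.map (MulAut.conj m₁).toMonoidHom) ≠ 0 :=
    fun h0 => hS₁ (Subgroup.relIndex_eq_zero_of_le_left hS₂ h0)
  have hW := eq_of_relIndex_ne_zero_of_mem_verticialSubgroups h37ii hℋ37 cℋ hW₁ hW₂ hW₂W₁
  -- total estrangement: one host, one branch containing the nontrivial `φ(ψ(Π_b))`
  exact branch_eq_of_hosts_eq h37ii h37i hℋ37 cℋ Ψ hΨ hne₁ (F.base.abuts_branchMap b v hv)
    (F'.base.abuts_branchMap b v hv) m₁ m₂ hle₁ hle₂ hW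

/-- **Cor. 3.9 (b), uniqueness of the underlying morphism of semi-graphs** (p. 268, "manifestly
unique"): two locally open `F, F' : G → H` compatible with the same `φ` on verticial and edge
homomorphisms have the same underlying `SemiGraph.Hom` — vertex map (`compatible_vertexMap_eq`),
edge map (R4 `CompatibleEdgeMapUnique_of`) and branch maps (`compatible_branchMap_eq`) — modulo
Thm. 3.7 (i) and (iii). [cite: MochizukiSemiAnbd2006, Cor 3.9 pp.42-43] -/
theorem compatible_base_eq (h37i : VerticialInjective.{u}) (h37iii : CompactInVerticial.{u})
    (h𝒢 : Cor39Hypotheses 𝒢) (hℋ : Cor39Hypotheses ℋ) (c𝒢 : TemperedPiChart 𝒢)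
    (cℋ : TemperedPiChart ℋ) {F F' : Hom 𝒢 ℋ} {φ : c𝒢.G →ₜ* cℋ.G} (hF : F.IsLocallyOpen)
    (hF' : F'.IsLocallyOpen) (hV : F.CompatV c𝒢 cℋ φ) (hE : F.CompatE c𝒢 cℋ φ)
    (hV' : F'.CompatV c𝒢 cℋ φ) (hE' : F'.CompatE c𝒢 cℋ φ) : F.base = F'.base := by
  have hv : F.base.vertexMap = F'.base.vertexMap :=
    compatible_vertexMap_eq h37i verticialDistinct_holds h𝒢 hℋ c𝒢 cℋ hF hV hV'
  exact SemiGraph.Hom.ext hv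
    (CompatibleEdgeMapUnique_of (edgeLikeDistinct_of_compactInVerticial h37iii) h37i 𝒢 ℋ h𝒢 hℋ
      c𝒢 cℋ F F' φ hF hF' hV hE hV' hE' hv)
    (compatible_branchMap_eq h37i verticialDistinct_holds h𝒢 hℋ c𝒢 cℋ hF hF' hV hV')

/-- **Unconditional form** of `compatible_branchMap_eq`, binding Thm. 3.7 (i) `verticialInjective_holds`
and (ii) `verticialDistinct_holds`: the branch maps of a locally open morphism compatible with `φ`
on verticial homomorphisms are determined by `φ`. [cite: MochizukiSemiAnbd2006, Cor 3.9 pp.42-43] -/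
theorem branchMap_eq_of_compatV (h𝒢 : Cor39Hypotheses 𝒢) (hℋ : Cor39Hypotheses ℋ)
    (c𝒢 : TemperedPiChart 𝒢) (cℋ : TemperedPiChart ℋ) {F F' : Hom 𝒢 ℋ} {φ : c𝒢.G →ₜ* cℋ.G}
    (hF : F.IsLocallyOpen) (hF' : F'.IsLocallyOpen) (hV : F.CompatV c𝒢 cℋ φ)
    (hV' : F'.CompatV c𝒢 cℋ φ) : F.base.branchMap = F'.base.branchMap :=
  compatible_branchMap_eq verticialInjective_holds verticialDistinct_holds h𝒢 hℋ c𝒢 cℋ hF hF' hV hV'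

/-- The same in the currency of `Cor39Compat` (`F.Induces`), via R1 `InducesCompatible_holds`: the
underlying morphism of semi-graphs of a locally open `F` inducing `φ` is unique.
[cite: MochizukiSemiAnbd2006, Cor 3.9 pp.42-43] -/
theorem base_eq_of_induces (h37i : VerticialInjective.{u}) (h37iii : CompactInVerticial.{u})
    (h𝒢 : Cor39Hypotheses 𝒢) (hℋ : Cor39Hypotheses ℋ) (c𝒢 : TemperedPiChart 𝒢)
    (cℋ : TemperedPiChart ℋ) {F F' : Hom 𝒢 ℋ} {φ : c𝒢.G →ₜ* cℋ.G} (hF : F.IsLocallyOpen)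
    (hF' : F'.IsLocallyOpen) (hind : F.Induces c𝒢 cℋ φ) (hind' : F'.Induces c𝒢 cℋ φ) :
    F.base = F'.base := by
  obtain ⟨hV, hE⟩ := InducesCompatible_holds 𝒢 ℋ h𝒢 hℋ c𝒢 cℋ F φ hind
  obtain ⟨hV', hE'⟩ := InducesCompatible_holds 𝒢 ℋ h𝒢 hℋ c𝒢 cℋ F' φ hind'
  exact compatible_base_eq h37i h37iii h𝒢 hℋ c𝒢 cℋ hF hF' hV hE hV' hE'

/-- **Unconditional-in-(i) form**: binding `verticialInjective_holds`, the underlying morphism of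
semi-graphs in Cor. 3.9 (b) is unique modulo Thm. 3.7 (iii) `CompactInVerticial` alone.
[cite: MochizukiSemiAnbd2006, Cor 3.9 pp.42-43] -/
theorem base_eq_of_induces_of_compactInVerticial (h37iii : CompactInVerticial.{u})
    (h𝒢 : Cor39Hypotheses 𝒢) (hℋ : Cor39Hypotheses ℋ) (c𝒢 : TemperedPiChart 𝒢)
    (cℋ : TemperedPiChart ℋ) {F F' : Hom 𝒢 ℋ} {φ : c𝒢.G →ₜ* cℋ.G} (hF : F.IsLocallyOpen)
    (hF' : F'.IsLocallyOpen) (hind : F.Induces c𝒢 cℋ φ) (hind' : F'.Induces c𝒢 cℋ φ) :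
    F.base = F'.base :=
  base_eq_of_induces verticialInjective_holds h37iii h𝒢 hℋ c𝒢 cℋ hF hF' hind hind'

/-! ### The capstone: Cor. 3.9 under the compatible reading, modulo Thm 3.7 (iii) and R3 -/

/-- **`Cor39Compat` modulo Thm. 3.7 (iii) `CompactInVerticial` and R3 `InducesOfCompatible`**: t2's
assembly `cor39Compat_of_thm37_i_iii` with Thm. 3.7 (i) bound to `verticialInjective_holds` and R2′
discharged by `quasiGeometricGraphDataCompat_of_compactInVerticial`.
[cite: MochizukiSemiAnbd2006, Cor 3.9 pp.42-43] -/
theorem cor39Compat_of_compactInVerticial (h37iii : CompactInVerticial.{u})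
    (hR3 : InducesOfCompatible.{u}) : Cor39Compat.{u} :=
  cor39Compat_of_thm37_i_iii verticialInjective_holds h37iii
    (quasiGeometricGraphDataCompat_of_compactInVerticial h37iii) hR3

/-- **Cor. 3.9 as a bijection under the compatible reading of Def. 3.8** (p. 267: "a natural bijective
correspondence between locally open morphisms … and quasi-geometric morphisms"), modulo Thm. 3.7
(iii) and R3: (a′) a homomorphism induced by a locally open `F : G → H` is COMPATIBLY quasi-geometric;
(b′) a compatibly quasi-geometric `φ` is induced by a locally open `F`, and the underlying morphism of
semi-graphs of any such `F` is uniquely determined (vertex, edge AND branch maps).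
[cite: MochizukiSemiAnbd2006, Cor 3.9 pp.42-43] -/
theorem cor39Compat_bijection_of_compactInVerticial (h37iii : CompactInVerticial.{u})
    (hR3 : InducesOfCompatible.{u}) (𝒢 ℋ : ProfiniteSemiGraph.{u}) (h𝒢 : Cor39Hypotheses 𝒢)
    (hℋ : Cor39Hypotheses ℋ) (c𝒢 : TemperedPiChart 𝒢) (cℋ : TemperedPiChart ℋ) :
    (∀ F : Hom 𝒢 ℋ, F.IsLocallyOpen → ∀ φ : c𝒢.G →ₜ* cℋ.G, F.Induces c𝒢 cℋ φ →
        IsCompatiblyQuasiGeometric φ) ∧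
      ∀ φ : c𝒢.G →ₜ* cℋ.G, IsCompatiblyQuasiGeometric φ →
        ∃ F : Hom 𝒢 ℋ, F.IsLocallyOpen ∧ F.Induces c𝒢 cℋ φ ∧
          ∀ F' : Hom 𝒢 ℋ, F'.IsLocallyOpen → F'.Induces c𝒢 cℋ φ → F'.base = F.base := by
  have h37iv := maximalCompactIffVerticial_of_compactInVerticial h37iii
  refine ⟨fun F hF φ hind => ?_, fun φ hφ => ?_⟩
  · obtain ⟨hV, hE⟩ := InducesCompatible_holds 𝒢 ℋ h𝒢 hℋ c𝒢 cℋ F φ hind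
    exact isCompatiblyQuasiGeometric_of_compat verticialInjective_holds verticialDistinct_holds h37iii
      h37iv h𝒢 hℋ c𝒢 cℋ F φ hF hV hE
  · obtain ⟨F, hF, hV, hE⟩ :=
      quasiGeometricGraphDataCompat_of_compactInVerticial h37iii 𝒢 ℋ h𝒢 hℋ c𝒢 cℋ φ hφ
    have hind : F.Induces c𝒢 cℋ φ := hR3 𝒢 ℋ h𝒢 hℋ c𝒢 cℋ F φ hF hV hE
    exact ⟨F, hF, hind, fun F' hF' hind' =>
      (base_eq_of_induces_of_compactInVerticial h37iii h𝒢 hℋ c𝒢 cℋ hF hF' hind hind').symm⟩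

/-! ### Unconditional forms: the edge map from the branch maps (appended) -/

/-- The edge map of a morphism of semi-graphs is determined by its map of branches (every edge is a
set of two branches). [cite: MochizukiSemiAnbd2006, §1 p.11] -/
theorem _root_.Literature.AnabelianGeometry.SemiGraphs.SemiGraph.Hom.edgeMap_eq_of_branchMap_eq
    {G G' : SemiGraph.{u}} (f f' : SemiGraph.Hom G G') (h : f.branchMap = f'.branchMap) :
    f.edgeMap = f'.edgeMap := by
  funext e
  obtain ⟨b, -, -, hb, -, -⟩ := G.two_branches e
  rw [← hb, ← f.edgeOf_branchMap, ← f'.edgeOf_branchMap, h]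

/-- A morphism of semi-graphs is determined by its vertex map and its map of branches.
[cite: MochizukiSemiAnbd2006, §1 p.11] -/
theorem _root_.Literature.AnabelianGeometry.SemiGraphs.SemiGraph.Hom.ext_of_branchMap
    {G G' : SemiGraph.{u}} {f f' : SemiGraph.Hom G G'} (hv : f.vertexMap = f'.vertexMap)
    (hb : f.branchMap = f'.branchMap) : f = f' :=
  SemiGraph.Hom.ext hv (SemiGraph.Hom.edgeMap_eq_of_branchMap_eq f f' hb) hb

/-- **Cor. 3.9 (b), uniqueness of the underlying morphism of semi-graphs — UNCONDITIONAL and from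
`CompatV` alone**: two locally open `F, F' : G → H` (with `G` a graph) compatible with the same `φ`
on verticial homomorphisms have the same underlying `SemiGraph.Hom`.  Vertex map: t2's
`compatible_vertexMap_eq`; branch maps: `compatible_branchMap_eq`; the edge map follows from the
branch maps — so neither `CompatE` nor Thm. 3.7 (iii) (nor the edge analogue R4 / `EdgeLikeDistinct`)
is needed, Thm. 3.7 (i), (ii) being theorems of the tree. [cite: MochizukiSemiAnbd2006, Cor 3.9 pp.42-43] -/
theorem base_eq_of_compatV (h𝒢 : Cor39Hypotheses 𝒢) (hℋ : Cor39Hypotheses ℋ)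
    (c𝒢 : TemperedPiChart 𝒢) (cℋ : TemperedPiChart ℋ) {F F' : Hom 𝒢 ℋ} {φ : c𝒢.G →ₜ* cℋ.G}
    (hF : F.IsLocallyOpen) (hF' : F'.IsLocallyOpen) (hV : F.CompatV c𝒢 cℋ φ)
    (hV' : F'.CompatV c𝒢 cℋ φ) : F.base = F'.base :=
  SemiGraph.Hom.ext_of_branchMap
    (compatible_vertexMap_eq verticialInjective_holds verticialDistinct_holds h𝒢 hℋ c𝒢 cℋ hF hV hV')
    (branchMap_eq_of_compatV h𝒢 hℋ c𝒢 cℋ hF hF' hV hV')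

/-- The same in the currency of `Hom.Induces` (R1 `InducesCompatible_holds`), UNCONDITIONAL: the
underlying morphism of semi-graphs of a locally open `F` inducing `φ` is unique.
[cite: MochizukiSemiAnbd2006, Cor 3.9 pp.42-43] -/
theorem base_eq_of_induces' (h𝒢 : Cor39Hypotheses 𝒢) (hℋ : Cor39Hypotheses ℋ)
    (c𝒢 : TemperedPiChart 𝒢) (cℋ : TemperedPiChart ℋ) {F F' : Hom 𝒢 ℋ} {φ : c𝒢.G →ₜ* cℋ.G}
    (hF : F.IsLocallyOpen) (hF' : F'.IsLocallyOpen) (hind : F.Induces c𝒢 cℋ φ)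
    (hind' : F'.Induces c𝒢 cℋ φ) : F.base = F'.base :=
  base_eq_of_compatV h𝒢 hℋ c𝒢 cℋ hF hF' (InducesCompatible_holds 𝒢 ℋ h𝒢 hℋ c𝒢 cℋ F φ hind).1
    (InducesCompatible_holds 𝒢 ℋ h𝒢 hℋ c𝒢 cℋ F' φ hind').1

/-- **R4 `CompatibleEdgeMapUnique` UNCONDITIONALLY** (and without its `CompatE` / vertex-map
hypotheses being used): the edge map compatible with a given `φ` is unique — a by-product of the
branch-map uniqueness. [cite: MochizukiSemiAnbd2006, Cor 3.9 p.43] -/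
theorem compatibleEdgeMapUnique_holds : CompatibleEdgeMapUnique.{u} :=
  fun _ _ h𝒢 hℋ c𝒢 cℋ _ _ _ hF hF' hV _ hV' _ _ =>
    SemiGraph.Hom.edgeMap_eq_of_branchMap_eq _ _ (branchMap_eq_of_compatV h𝒢 hℋ c𝒢 cℋ hF hF' hV hV')

end ProfiniteSemiGraph

end Literature.AnabelianGeometry.SemiGraphs
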